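import Summits.HodgeConjecture.HodgeCM.Model.ToyG2.ThetaGram_1

/-! PORT of `HodgeCM/Model/ToyG2/ThetaGram.lean` (HodgeCMPerL run 82) — part 2: continuation of `Summits.HodgeConjecture.HodgeCM.Model.ToyG2.ThetaGram_1` (split at a top-level declaration boundary by port_pkg.py; scope re-opened below; declarations unchanged). -/

-- port_pkg: scope re-opened for this part (file-level context, then the namespace/section stack open at the cut)
open scoped TensorProduct InnerProductSpace
open HodgeCM.Toy HodgeCM.Toy.CMPresentation exteriorPower NumberField.ComplexEmbedding
open Literature.AlgebraicGeometry.Motives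
namespace HodgeCM.ToyG2.ThetaUiso
noncomputable section
open scoped Classical
section Entries
variable {L : CMField} (ι₁ : L →+* ℂ) (d t : ℚ) (q : Fin (nQ L ι₁))
/-- permuting the slot pattern of an eigenvector family: `ℓ_ℂ(e ∘ σ) = sign σ · ℓ_ℂ(e)` -/
theorem baseCA_ell_perm (σ : Equiv.Perm (Fin 4)) (χ : Fin 4 → (FK L →+* ℂ)) :
    baseCA (PP L (ΘOf L ι₁ q)) (ellLin L (ΘOf L ι₁ q) (ξOf L ι₁ q) d t)
        (fun j => (PP L (ΘOf L ι₁ q)).eB (ix L (ΘOf L ι₁ q) (χ j) (σ j)))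
      = Equiv.Perm.sign σ • baseCA (PP L (ΘOf L ι₁ q)) (ellLin L (ΘOf L ι₁ q) (ξOf L ι₁ q) d t)
        (fun j => (PP L (ΘOf L ι₁ q)).eB (ix L (ΘOf L ι₁ q) (χ (σ.symm j)) j)) := by
  have h : (fun j => (PP L (ΘOf L ι₁ q)).eB (ix L (ΘOf L ι₁ q) (χ j) (σ j)))
      = (fun j => (PP L (ΘOf L ι₁ q)).eB (ix L (ΘOf L ι₁ q) (χ (σ.symm j)) j)) ∘ σ := by
    funext j
    simp only [Function.comp_apply, Equiv.symm_apply_apply]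
  rw [h, AlternatingMap.map_perm]

/-- **SAME SHAPE** `(a,b,a,b)`, `a < b`:
`ℓ_ℂ(e_{a,θ}, e_{b,θ'}, e_{a,φ}, e_{b,φ'}) = -ellCoef · (2θ(ξ_a)[φ = θ̄]) · (2θ'(ξ_b)[φ' = θ̄'])`. -/
theorem baseCA_ell_sameShape {a b : Fin 4} (hab : a < b) (θ θ' φ φ' : FK L →+* ℂ) :
    baseCA (PP L (ΘOf L ι₁ q)) (ellLin L (ΘOf L ι₁ q) (ξOf L ι₁ q) d t)
        (fun j => (PP L (ΘOf L ι₁ q)).eB (ix L (ΘOf L ι₁ q) (![θ, θ', φ, φ'] j) (![a, b, a, b] j)))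
      = -((ellCoef d a b : ℂ)
          * ((if φ = conjugate θ then 2 * θ (eK L (ξOf L ι₁ q a)) else 0)
            * (if φ' = conjugate θ' then 2 * θ' (eK L (ξOf L ι₁ q b)) else 0))) := by
  have hperm : (fun j => (PP L (ΘOf L ι₁ q)).eB (ix L (ΘOf L ι₁ q) (![θ, θ', φ, φ'] j) (![a, b, a, b] j)))
      = (fun j => (PP L (ΘOf L ι₁ q)).eB (ix L (ΘOf L ι₁ q) (![θ, φ, θ', φ'] j) (![a, a, b, b] j)))
          ∘ (Equiv.swap (1 : Fin 4) 2) := by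
    funext j
    fin_cases j <;> rfl
  rw [hperm, AlternatingMap.map_perm, baseCA_ell_pair_eq L (ΘOf L ι₁ q) d t (ξOf_conj L ι₁ q) hab,
    Equiv.Perm.sign_swap (by decide), Units.neg_smul, one_smul]
  simp only [v4_0, v4_1, v4_2, v4_3]

/-- the sorting permutation of the cross pattern `(sh₁ k r, sh₂ k r, sh₁ k ¬r, sh₂ k ¬r)` … -/
def crossPerm : Fin 3 → Bool → Equiv.Perm (Fin 4)
  | 0, false => Equiv.swap 0 2 * Equiv.swap 1 3
  | 0, true => 1
  | 1, false => Equiv.swap 1 2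
  | 1, true => Equiv.swap 0 1 * Equiv.swap 1 3 * Equiv.swap 2 3
  | 2, false => Equiv.swap 1 3 * Equiv.swap 2 3
  | 2, true => Equiv.swap 0 1 * Equiv.swap 1 2

/-- … and its inverse, as a table -/
def cinv : Fin 3 → Bool → Fin 4 → Fin 4
  | 0, false => ![2, 3, 0, 1]
  | 0, true => ![0, 1, 2, 3]
  | 1, false => ![0, 2, 1, 3]
  | 1, true => ![2, 0, 3, 1]
  | 2, false => ![0, 2, 3, 1]
  | 2, true => ![2, 0, 1, 3]

/-- (Ported verbatim from the HodgeCMPerL package; no docstring in the source.) -/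
theorem crossPerm_apply (k : Fin 3) (r : Bool) (j : Fin 4) :
    crossPerm k r j = ![sh₁ k r, sh₂ k r, sh₁ k (!r), sh₂ k (!r)] j := by
  revert k r j; decide

/-- (Ported verbatim from the HodgeCMPerL package; no docstring in the source.) -/
theorem cinv_crossPerm (k : Fin 3) (r : Bool) (j : Fin 4) : cinv k r (crossPerm k r j) = j := by
  revert k r j; decide

/-- (Ported verbatim from the HodgeCMPerL package; no docstring in the source.) -/
theorem crossPerm_symm_apply (k : Fin 3) (r : Bool) (j : Fin 4) : (crossPerm k r).symm j = cinv k r j := by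
  rw [Equiv.symm_apply_eq]
  have h : ∀ (k : Fin 3) (r : Bool) (j : Fin 4), crossPerm k r (cinv k r j) = j := by decide
  exact (h k r j).symm

/-- (Ported verbatim from the HodgeCMPerL package; no docstring in the source.) -/
theorem sign_crossPerm (k : Fin 3) (r : Bool) :
    Equiv.Perm.sign (crossPerm k r) = if k = 1 then -1 else 1 := by
  fin_cases k <;> cases r <;>
    simp [crossPerm, Equiv.Perm.sign_mul, Equiv.Perm.sign_swap', Fin.ext_iff]

/-- **CROSS SHAPE** (the two partner shapes of couple `k`): only the twist term of `ℓ` survives, sorted by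
`crossPerm k r`. -/
theorem baseCA_ell_cross (k : Fin 3) (r : Bool) (χ : Fin 4 → (FK L →+* ℂ)) :
    baseCA (PP L (ΘOf L ι₁ q)) (ellLin L (ΘOf L ι₁ q) (ξOf L ι₁ q) d t)
        (fun j => (PP L (ΘOf L ι₁ q)).eB
          (ix L (ΘOf L ι₁ q) (χ j) (![sh₁ k r, sh₂ k r, sh₁ k (!r), sh₂ k (!r)] j)))
      = Equiv.Perm.sign (crossPerm k r) • ((t : ℂ)
          * (if χ (cinv k r 0) = χ (cinv k r 1) ∧ conjugate (χ (cinv k r 0)) = χ (cinv k r 2)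
                ∧ conjugate (χ (cinv k r 0)) = χ (cinv k r 3)
             then χ (cinv k r 0) (eK L (ξOf L ι₁ q 2 * ξOf L ι₁ q 3)) else 0)) := by
  have hfam : (fun j => (PP L (ΘOf L ι₁ q)).eB
        (ix L (ΘOf L ι₁ q) (χ j) (![sh₁ k r, sh₂ k r, sh₁ k (!r), sh₂ k (!r)] j)))
      = (fun j => (PP L (ΘOf L ι₁ q)).eB (ix L (ΘOf L ι₁ q) (χ j) (crossPerm k r j))) := by
    funext j
    rw [crossPerm_apply]
  rw [hfam, baseCA_ell_perm, baseCA_ell_sorted]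
  simp only [crossPerm_symm_apply]

variable (hd : (1 : ℚ) ≤ d) (ht : t ^ 2 = 16)

/-- (Ported verbatim from the HodgeCMPerL package; no docstring in the source.) -/
@[simp] theorem blockData_s : (blockData ι₁ d t hd ht q).s = sW ι₁ q := rfl
/-- (Ported verbatim from the HodgeCMPerL package; no docstring in the source.) -/
@[simp] theorem blockData_c : (blockData ι₁ d t hd ht q).c = conjugate := rfl
/-- (Ported verbatim from the HodgeCMPerL package; no docstring in the source.) -/
@[simp] theorem blockData_d : (blockData ι₁ d t hd ht q).d = d := rfl
/-- (Ported verbatim from the HodgeCMPerL package; no docstring in the source.) -/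
@[simp] theorem blockData_β (k : Fin 3) (θ : FK L →+* ℂ) :
    (blockData ι₁ d t hd ht q).β k θ = ε k * ((t : ℝ) / 4) * (sW ι₁ q 2 θ * sW ι₁ q 3 θ) := rfl

/-- off-diagonal entries between a role-`false` and a role-`true` index of the same couple, in closed form -/
theorem C_false_true {E : Type} [Fintype E] [DecidableEq E] (X : BlockData E) (k : Fin 3)
    (θ θ' φ φ' : E) (hu : X.valid (k, false, θ, θ')) (hv : X.valid (k, true, φ, φ')) :
    X.C (k, false, θ, θ') (k, true, φ, φ')
      = if θ' = X.τ k θ ∧ φ = X.τ k θ ∧ φ' = θ then X.β k θ else 0 := by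
  split_ifs with h
  · obtain ⟨rfl, rfl, rfl⟩ := h
    exact X.C_fst_sec ⟨hu, hv⟩
  · refine X.C_eq_zero fun k' θ'' _ => ⟨?_, ?_⟩
    · rintro ⟨h1, h2⟩
      simp only [BlockData.fst, BlockData.sec, Prod.mk.injEq] at h1 h2
      obtain ⟨rfl, -, rfl, h1'⟩ := h1
      exact h ⟨h1', h2.2.2.1, h2.2.2.2⟩
    · rintro ⟨h1, -⟩
      simp [BlockData.sec] at h1

/-- the slot pattern of two pair-indices of DIFFERENT couples is inadmissible for `ℓ` -/
theorem cross_couple_pattern {ku kv : Fin 3} (hk : ku ≠ kv) (ru rv : Bool) :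
    (∀ a b : Fin 4, a ≠ b →
      (Finset.univ.filter fun c => ![sh₁ ku ru, sh₂ ku ru, sh₁ kv rv, sh₂ kv rv] c = a).card < 2 ∨
        (Finset.univ.filter fun c => ![sh₁ ku ru, sh₂ ku ru, sh₁ kv rv, sh₂ kv rv] c = b).card < 2) ∧
    (∃ c₀ : Fin 4, ∀ c, ![sh₁ ku ru, sh₂ ku ru, sh₁ kv rv, sh₂ kv rv] c ≠ c₀) := by
  revert ku kv ru rv; decide

/-- `¼ · t · χ(ξ₂ξ₃) = -(t/4) s₂(χ) s₃(χ)` -/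
theorem quarter_t_emb (χ : FK L →+* ℂ) :
    (1 / 4 : ℂ) * ((t : ℂ) * χ (eK L (ξOf L ι₁ q 2 * ξOf L ι₁ q 3)))
      = -((((t : ℝ) / 4) * (sW ι₁ q 2 χ * sW ι₁ q 3 χ) : ℝ) : ℂ) := by
  rw [emb_ξOf_mul]; push_cast; ring

/-- (Ported verbatim from the HodgeCMPerL package; no docstring in the source.) -/
theorem quarter_t_conj_emb (χ : FK L →+* ℂ) :
    (1 / 4 : ℂ) * ((t : ℂ) * (conjugate χ) (eK L (ξOf L ι₁ q 2 * ξOf L ι₁ q 3)))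
      = -((((t : ℝ) / 4) * (sW ι₁ q 2 χ * sW ι₁ q 3 χ) : ℝ) : ℂ) := by
  rw [conj_emb_ξOf_mul]; push_cast; ring

/-- the cross entries, role `false` against role `true` of ONE couple `k`: `C u v = ¼ ℓ_ℂ(…)` -/
theorem cross_false_true (k : Fin 3) (θ θ' φ φ' : FK L →+* ℂ)
    (hu : (blockData ι₁ d t hd ht q).valid (k, false, θ, θ'))
    (hv : (blockData ι₁ d t hd ht q).valid (k, true, φ, φ')) :
    (((blockData ι₁ d t hd ht q).C (k, false, θ, θ') (k, true, φ, φ') : ℝ) : ℂ)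
      = (1 / 4 : ℂ) * baseCA (PP L (ΘOf L ι₁ q)) (ellLin L (ΘOf L ι₁ q) (ξOf L ι₁ q) d t)
        (fun j => (PP L (ΘOf L ι₁ q)).eB (ix L (ΘOf L ι₁ q)
          (![θ, θ', conjugate φ, conjugate φ'] j) (![sh₁ k false, sh₂ k false, sh₁ k true, sh₂ k true] j))) := by
  rw [C_false_true _ k θ θ' φ φ' hu hv,
    show (![sh₁ k false, sh₂ k false, sh₁ k true, sh₂ k true] : Fin 4 → Fin 4)
      = ![sh₁ k false, sh₂ k false, sh₁ k (!false), sh₂ k (!false)] from rfl,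
    baseCA_ell_cross, sign_crossPerm]
  obtain rfl | rfl | rfl : k = 0 ∨ k = 1 ∨ k = 2 := by fin_cases k <;> decide
  · -- couple 0: `τ₀ = id`, sign `+1`, `β₀ = -(t/4) s₂ s₃`
    rw [if_neg (show ¬ ((0 : Fin 3) = 1) by decide), one_smul]
    by_cases hc : θ' = (blockData ι₁ d t hd ht q).τ 0 θ ∧ φ = (blockData ι₁ d t hd ht q).τ 0 θ ∧ φ' = θ
    · rw [if_pos hc, if_pos]
      · simp only [BlockData.τ, if_true] at hc
        obtain ⟨rfl, rfl, rfl⟩ := hc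
        simp only [cinv, v4_0, v4_2, quarter_t_conj_emb, blockData_β, ε,
          show ¬ ((0 : Fin 3) = 1) by decide, if_false]
        push_cast; ring
      · simp only [BlockData.τ, if_true] at hc
        obtain ⟨rfl, rfl, rfl⟩ := hc
        simp [cinv]
    · rw [if_neg hc, if_neg]
      · simp
      · intro h
        apply hc
        simp only [cinv, v4_0, v4_1, v4_2, v4_3, conjugate_inj', conjugate_conjugate'] at h
        obtain ⟨h1, h2, h3⟩ := h
        subst h2 h3
        simp only [BlockData.τ, if_true, true_and]
        exact h1.symm
  · -- couple 1: `τ₁ = c`, sign `-1`, `β₁ = +(t/4) s₂ s₃`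
    rw [if_pos rfl, Units.neg_smul, one_smul, mul_neg]
    by_cases hc : θ' = (blockData ι₁ d t hd ht q).τ 1 θ ∧ φ = (blockData ι₁ d t hd ht q).τ 1 θ ∧ φ' = θ
    · rw [if_pos hc, if_pos]
      · simp only [BlockData.τ, blockData_c, show ¬ ((1 : Fin 3) = 0) by decide, if_false] at hc
        obtain ⟨rfl, rfl, rfl⟩ := hc
        simp only [cinv, v4_0, quarter_t_emb, blockData_β, ε, if_true]
        push_cast; ring
      · simp only [BlockData.τ, blockData_c, show ¬ ((1 : Fin 3) = 0) by decide, if_false] at hc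
        obtain ⟨rfl, rfl, rfl⟩ := hc
        simp [cinv]
    · rw [if_neg hc, if_neg]
      · simp
      · intro h
        apply hc
        simp only [cinv, v4_0, v4_1, v4_2, v4_3, conjugate_inj'] at h
        obtain ⟨h1, h2, h3⟩ := h
        subst h1 h2 h3
        simp [BlockData.τ]
  · -- couple 2: `τ₂ = c`, sign `+1`, `β₂ = -(t/4) s₂ s₃`
    rw [if_neg (show ¬ ((2 : Fin 3) = 1) by decide), one_smul]
    by_cases hc : θ' = (blockData ι₁ d t hd ht q).τ 2 θ ∧ φ = (blockData ι₁ d t hd ht q).τ 2 θ ∧ φ' = θ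
    · rw [if_pos hc, if_pos]
      · simp only [BlockData.τ, blockData_c, show ¬ ((2 : Fin 3) = 0) by decide, if_false] at hc
        obtain ⟨rfl, rfl, rfl⟩ := hc
        simp only [cinv, v4_0, quarter_t_emb, blockData_β, ε,
          show ¬ ((2 : Fin 3) = 1) by decide, if_false]
        push_cast; ring
      · simp only [BlockData.τ, blockData_c, show ¬ ((2 : Fin 3) = 0) by decide, if_false] at hc
        obtain ⟨rfl, rfl, rfl⟩ := hc
        simp [cinv]
    · rw [if_neg hc, if_neg]
      · simp
      · intro h
        apply hc
        simp only [cinv, v4_0, v4_1, v4_2, v4_3, conjugate_inj'] at h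
        obtain ⟨h1, h2, h3⟩ := h
        subst h1 h2 h3
        simp [BlockData.τ]

/-- the cross entries, role `true` against role `false` -/
theorem cross_true_false (k : Fin 3) (θ θ' φ φ' : FK L →+* ℂ)
    (hu : (blockData ι₁ d t hd ht q).valid (k, true, θ, θ'))
    (hv : (blockData ι₁ d t hd ht q).valid (k, false, φ, φ')) :
    (((blockData ι₁ d t hd ht q).C (k, true, θ, θ') (k, false, φ, φ') : ℝ) : ℂ)
      = (1 / 4 : ℂ) * baseCA (PP L (ΘOf L ι₁ q)) (ellLin L (ΘOf L ι₁ q) (ξOf L ι₁ q) d t)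
        (fun j => (PP L (ΘOf L ι₁ q)).eB (ix L (ΘOf L ι₁ q)
          (![θ, θ', conjugate φ, conjugate φ'] j) (![sh₁ k true, sh₂ k true, sh₁ k false, sh₂ k false] j))) := by
  rw [(blockData ι₁ d t hd ht q).C_symm, C_false_true _ k φ φ' θ θ' hv hu,
    show (![sh₁ k true, sh₂ k true, sh₁ k false, sh₂ k false] : Fin 4 → Fin 4)
      = ![sh₁ k true, sh₂ k true, sh₁ k (!true), sh₂ k (!true)] from rfl,
    baseCA_ell_cross, sign_crossPerm]
  obtain rfl | rfl | rfl : k = 0 ∨ k = 1 ∨ k = 2 := by fin_cases k <;> decide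
  · rw [if_neg (show ¬ ((0 : Fin 3) = 1) by decide), one_smul]
    by_cases hc : φ' = (blockData ι₁ d t hd ht q).τ 0 φ ∧ θ = (blockData ι₁ d t hd ht q).τ 0 φ ∧ θ' = φ
    · rw [if_pos hc, if_pos]
      · simp only [BlockData.τ, if_true] at hc
        obtain ⟨rfl, rfl, rfl⟩ := hc
        simp only [cinv, v4_0, quarter_t_emb, blockData_β, ε,
          show ¬ ((0 : Fin 3) = 1) by decide, if_false]
        push_cast; ring
      · simp only [BlockData.τ, if_true] at hc
        obtain ⟨rfl, rfl, rfl⟩ := hc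
        simp [cinv]
    · rw [if_neg hc, if_neg]
      · simp
      · intro h
        apply hc
        simp only [cinv, v4_0, v4_1, v4_2, v4_3, conjugate_inj'] at h
        obtain ⟨h1, h2, h3⟩ := h
        subst h2 h3
        simp only [BlockData.τ, if_true, true_and]
        exact h1.symm
  · rw [if_pos rfl, Units.neg_smul, one_smul, mul_neg]
    by_cases hc : φ' = (blockData ι₁ d t hd ht q).τ 1 φ ∧ θ = (blockData ι₁ d t hd ht q).τ 1 φ ∧ θ' = φ
    · rw [if_pos hc, if_pos]
      · simp only [BlockData.τ, blockData_c, show ¬ ((1 : Fin 3) = 0) by decide, if_false] at hc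
        obtain ⟨rfl, rfl, rfl⟩ := hc
        simp only [cinv, v4_0, v4_2, quarter_t_conj_emb, blockData_β, ε, if_true]
        push_cast; ring
      · simp only [BlockData.τ, blockData_c, show ¬ ((1 : Fin 3) = 0) by decide, if_false] at hc
        obtain ⟨rfl, rfl, rfl⟩ := hc
        simp [cinv]
    · rw [if_neg hc, if_neg]
      · simp
      · intro h
        apply hc
        simp only [cinv, v4_0, v4_1, v4_2, v4_3, conjugate_conjugate'] at h
        obtain ⟨h1, h2, h3⟩ := h
        subst h1 h2 h3
        simp [BlockData.τ]
  · rw [if_neg (show ¬ ((2 : Fin 3) = 1) by decide), one_smul]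
    by_cases hc : φ' = (blockData ι₁ d t hd ht q).τ 2 φ ∧ θ = (blockData ι₁ d t hd ht q).τ 2 φ ∧ θ' = φ
    · rw [if_pos hc, if_pos]
      · simp only [BlockData.τ, blockData_c, show ¬ ((2 : Fin 3) = 0) by decide, if_false] at hc
        obtain ⟨rfl, rfl, rfl⟩ := hc
        simp only [cinv, v4_0, v4_2, quarter_t_conj_emb, blockData_β, ε,
          show ¬ ((2 : Fin 3) = 1) by decide, if_false]
        push_cast; ring
      · simp only [BlockData.τ, blockData_c, show ¬ ((2 : Fin 3) = 0) by decide, if_false] at hc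
        obtain ⟨rfl, rfl, rfl⟩ := hc
        simp [cinv]
    · rw [if_neg hc, if_neg]
      · simp
      · intro h
        apply hc
        simp only [cinv, v4_0, v4_1, v4_2, v4_3, conjugate_conjugate'] at h
        obtain ⟨h1, h2, h3⟩ := h
        subst h1 h2 h3
        simp [BlockData.τ]

/-- **THE GRAM ENTRIES ARE THE PERIODS.**  For basis pair-indices `u = (a,b;θ,θ')`, `v = (a',b';φ,φ')` of block
`q` (holomorphic pairs), toy-g2's Gram entry `∑ₓ g u x · g v x` (`= D u` resp. `C u v`) is one quarter of the
period `ℓ_ℂ(e_{a,θ}, e_{b,θ'}, e_{a',φ̄}, e_{b',φ̄'})` `= period(E_{a,θ}, E_{b,θ'}, E_{a',φ}, E_{b',φ'})`. -/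
theorem gram_eq_period (u v : W (FK L →+* ℂ)) (hu : (blockData ι₁ d t hd ht q).valid u)
    (hv : (blockData ι₁ d t hd ht q).valid v) :
    ((∑ x, (blockData ι₁ d t hd ht q).g u x * (blockData ι₁ d t hd ht q).g v x : ℝ) : ℂ)
      = (1 / 4 : ℂ) * baseCA (PP L (ΘOf L ι₁ q)) (ellLin L (ΘOf L ι₁ q) (ξOf L ι₁ q) d t)
        (fun j => (PP L (ΘOf L ι₁ q)).eB (ix L (ΘOf L ι₁ q)
          (![u.2.2.1, u.2.2.2, conjugate v.2.2.1, conjugate v.2.2.2] j)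
          (![sh₁ u.1 u.2.1, sh₂ u.1 u.2.1, sh₁ v.1 v.2.1, sh₂ v.1 v.2.1] j))) := by
  by_cases huv : u = v
  · -- diagonal: `D u = coef · s_a s_b = ¼ · 4 ellCoef s_a s_b`
    subst huv
    rw [(blockData ι₁ d t hd ht q).inner_self hu]
    obtain ⟨k, r, θ, θ'⟩ := u
    dsimp only
    rw [baseCA_ell_sameShape ι₁ d t q (sh₁_lt_sh₂ k r), if_pos rfl, if_pos rfl, emb_ξOf_eq, emb_ξOf_eq,
      ellCoef_sh]
    simp only [BlockData.D, BlockData.coef, blockData_s, blockData_d]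
    have hI : Complex.I * Complex.I = -1 := Complex.I_mul_I
    split_ifs
    · push_cast
      linear_combination ((sW ι₁ q (sh₁ k r) θ : ℂ) * (sW ι₁ q (sh₂ k r) θ' : ℂ)) * hI
    · push_cast
      linear_combination ((d : ℂ) * (sW ι₁ q (sh₁ k r) θ : ℂ) * (sW ι₁ q (sh₂ k r) θ' : ℂ)) * hI
  · rw [(blockData ι₁ d t hd ht q).inner_of_ne huv]
    obtain ⟨ku, ru, θ, θ'⟩ := u
    obtain ⟨kv, rv, φ, φ'⟩ := v
    dsimp only at hu hv huv ⊢
    by_cases hk : ku = kv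
    · subst hk
      by_cases hr : ru = rv
      · -- same shape, `u ≠ v`: both sides vanish
        subst hr
        rw [baseCA_ell_sameShape ι₁ d t q (sh₁_lt_sh₂ ku ru), conjugate_inj', conjugate_inj']
        have hne : ¬ (φ = θ ∧ φ' = θ') := fun h => huv (by rw [h.1, h.2])
        rw [(blockData ι₁ d t hd ht q).C_eq_zero]
        · push_cast
          by_cases h1 : φ = θ
          · rw [if_neg (fun h2 => hne ⟨h1, h2⟩)]; ring
          · rw [if_neg h1]; ring
        · intro k' θ'' _
          constructor
          · rintro ⟨h1, h2⟩
            simp only [BlockData.fst, BlockData.sec, Prod.mk.injEq] at h1 h2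
            exact Bool.false_ne_true (h1.2.1.symm.trans h2.2.1)
          · rintro ⟨h1, h2⟩
            simp only [BlockData.fst, BlockData.sec, Prod.mk.injEq] at h1 h2
            exact Bool.false_ne_true (h2.2.1.symm.trans h1.2.1)
      · -- partner shapes of one couple: the twist term against `β`
        cases ru <;> cases rv
        · exact absurd rfl hr
        · exact cross_false_true ι₁ d t q hd ht ku θ θ' φ φ' hu hv
        · exact cross_true_false ι₁ d t q hd ht ku θ θ' φ φ' hu hv
        · exact absurd rfl hr
    · -- different couples: both sides vanish
      rw [(blockData ι₁ d t hd ht q).C_eq_zero, ← baseC_mono,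
        baseC_ell_mono_eq_zero L (ΘOf L ι₁ q) (ξOf L ι₁ q) d t _ _ (cross_couple_pattern hk ru rv).1
          (cross_couple_pattern hk ru rv).2]
      · simp
      · intro k' θ'' _
        constructor
        · rintro ⟨h1, h2⟩
          simp only [BlockData.fst, BlockData.sec, Prod.mk.injEq] at h1 h2
          exact hk (h1.1.trans h2.1.symm)
        · rintro ⟨h1, h2⟩
          simp only [BlockData.fst, BlockData.sec, Prod.mk.injEq] at h1 h2
          exact hk (h1.1.trans h2.1.symm)

end Entries

/-! ### §5 `inner_Λ` — on holomorphic eigenvector quadruples, then on all of `H¹⁰` by sesquilinearity -/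
section Vanishing

variable {L : CMField} (ι₁ : L →+* ℂ) (d t : ℚ) (q : Fin (nQ L ι₁))

/-- two holomorphic characters of one slot are never complex conjugate -/
theorem ne_conjugate_of_hol {a : Fin 4} {χ χ' : FK L →+* ℂ}
    (h : χ.comp (eK L : L →+* FK L) ∈ (ΘOf L ι₁ q a).1)
    (h' : χ'.comp (eK L : L →+* FK L) ∈ (ΘOf L ι₁ q a).1) : χ' ≠ conjugate χ := by
  rintro rfl
  exact ((conjugate_comp_mem_iff L (ΘOf L ι₁ q) χ a).mp h') h


-- port_pkg: scope closed for this part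
end Vanishing
end
end HodgeCM.ToyG2.ThetaUiso
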